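import Summits.QuantumFields.YangMills.Theorems.BalabanUVNodesN07SplitClauseHeadKnitRanged
import Summits.QuantumFields.YangMills.Theorems.BalabanUVNodesN07SplitClauseLevelRaisingMarginWide
import Summits.QuantumFields.YangMills.Theorems.BalabanUVNodesN07SplitClauseHeadKnitMeetNormalised
import Summits.QuantumFields.YangMills.Theorems.BalabanUVNodesN07SplitClauseHeadAtMeetCube
import Summits.QuantumFields.YangMills.Theorems.BalabanUVNodesN07MeetFamilyAtRecord
import Summits.QuantumFields.YangMills.Theorems.BalabanUVNodesN07ShearSizeTopBox
import Literature.MathematicalPhysics.QuantumFieldTheory.Balaban1983to89.Node00.DomainsRefinement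
import HarnessLib

/-!
# N07 [B11] (= [15] = [Balaban1985Variational]) Sect. F, S6 HEAD — THE MEET KNIT UNDER PRINT's NORMALISED LANDAU GAUGE, **PRINT-MARGIN EDITION** (repair of ⚑ LOCATED-MARGIN-WIDTH, referee ref-G
# READ454∕455): MODULE 59's knit (p653394) with HS3NORM ∕ HCHART-MEET-NORM owed only at datums whose print box WIDENED BY `2ρ` LEVEL-`j` BLOCKS — print's margin cube «□̃» of (144) ∕ [6] p. 98,
# `B8Eq131Cubes.tcube` — misses `Ω_{j+1}`; composed through MODULE 66's width-generic margin level raising at `w = 2ρ`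

Cell `pub-ymgap`, seat `pub-ymgap-dag-n07-e` g24 (FAN-OUT §N07 row s3; LANE OWNER of the K0 road), MODULE 67a (INTENT-67, cell bus).  `--kind proof --supports stmt-QuantumFields-20541 --as helper`
(K0⁷); count-neutral; def-free.  [15] = [Balaban1985Variational]; [6] = [Balaban1985RegularSpaces]; [4] = [Balaban1984PropagatorsII]; [I] = [Balaban1987RG1].

WHY.  MODULE 65a (`…HeadKnitMeetNormalisedMargin`, p663395) typed plan g87's cure (c2) of LOCATED-ADJACENT-RING with a margin of ONE level-`j` block.  Referee ref-G READ454 NOTE-1 (cell STATUS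
2026-08-28T20:16:15Z) located that this is too narrow: the chart's top box `[sqLo_j − 1, sqHi_j + 1]` — where MODULE 62's letter `δ̂` is read — is the print box widened by `ρ + 1` blocks
(`sqLo L a ρ j j = a − ρ`), and print's «□̃» is the print box widened by `2ρ` («dist(□̃, □ᶜ) = 2K₁M₁Lʲη», (144); «a distance of its boundary to □ is equal to 2R₁M₁», [6] p. 98); so 65a's
intended consequence «at a margin-clean datum the chart's whole top box misses `Ω_{j+1}`» does not follow from its typed premise for `ρ ≥ 1`.  MODULE 66 (`…N07SplitClauseLevelRaisingMarginWide`)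
re-typed the margin level raising with the width a parameter `w` (block tolerance `2w + 2ρ ≤ ρ·L + 1`, automatic for `w = 2ρ` from `L > 11`) and its PRINT corollary
`datumGaugeSplitTopStepCoreG_of_marginCleanPrint` (`w = 2ρ`).  THIS FILE is MODULE 65a verbatim with the two margin-clean premise lines of HS3NORM and HCHART-MEET-NORM widened to PRINT's margin
`K − n = k ∨ ∀ z ∈ box L (cornerP Mc ρ idx − 2ρ) (sideP Mc ρ + 4ρ) (K − n), π z ∉ Ω_{K−n+1}` («□̃ misses Ω_{j+1}», i.e. print's «□̃ ⊂ B^{j−1}(Λ_{j−1}) ∪ B^j(Λ_j)» on the `Ω_{j+1}` side) and the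
reduction call re-keyed — so the S3 pens and the chart lane owe their deliverables ONLY at meeting datums whose «□̃» misses `Ω_{j+1}`; by MODULE 66 §1 (`chartTopBox_subset_wboxPrint`,
`blowup_chartBox_subset_wboxPrint`) «□̃» CONTAINS the chart's top box and every lower chart box, so there «(7) for V» is available on ALL of `boxPlaqs (sqLo_j − 1) (sqHi_j + 1)` as 65a's header
intended.  Everything else BY NAME and unchanged (record side: 57a collar, FILE D0 `Adm22`, FILE C at zero shear, MODULE 59 §0's two lemmas).  MODULES 59 ∕ 65a stay correct (box-clean ∕
one-block editions); this edition's hypotheses are WEAKER than both (print-margin-clean ⇒ one-block-margin-clean ⇒ box-clean, MODULE 66 `wbox_mono` ∕ `box_subset_wbox_width`), same conclusion.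

WHAT IS PROVED (sorry-free; no definition; axioms standard).  ★★★ `datumGaugeSplitTopStepCoreG_of_normalisedGauge_of_chartMeetMarginWide F N`.  (The guarded [15] Prop. 8 step token from it
is the sibling `…HeadKnitMeetNormalisedMarginWideStep`, line budget.)
HONEST SCOPE.  Count-neutral by-name composition; HS3NORM (print-margin-clean), HCHART-MEET-NORM (print-margin-clean), HLETTERS-NORM ∕ HBUDGET-NORM, the two guard hypotheses, `2L² ≤ B₃` and
the smallness letters are HYPOTHESES — displayed, NOT discharged, joint satisfiability at the record NOT claimed; `Nrm` is abstract (`NrmOfRecord` of MODULE 60 is the text of record); NO stub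
registered or closed; nothing of [15]∕[6]∕[4] ANALYSIS asserted; K0⁷ ∕ K1⁹ NOT closed; N07 ∕ N05 NOT discharged; counts unmoved (typed 28∕28 · discharged 5∕27); one finite 𝕋⁴ programme at
fixed ε — the route closes the conditional finite-𝕋⁴ rung `BalabanLadder.UV` ONLY; the YM mass gap (Clay) is NOT proved by any of this; nothing continuum ∕ ℝ⁴ ∕ OS.  No `sorry`, no `def`, no
`instance`, no `notation`.

References: [15] (144) p. 300, (147)–(156) pp. 301–302, (157)–(159) pp. 302–303, (160)–(166) pp. 303–304, (168) p. 304, Prop. 8 p. 304; [6] Thm. 2 p. 83, p. 98, Prop. 6 p. 99,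
(1.29) p. 81, (1.3)–(1.9) p. 77, (1.131) p. 99; [4] (2.1)–(2.4) p. 224, Cor. 2.8 p. 249; [I] (0.1) p. 251.
-/

set_option autoImplicit false

noncomputable section
open scoped BigOperators Matrix.Norms.L2Operator

namespace Summit.QuantumFields.YangMills.BalabanUVNodes.N07SplitClauseHeadKnitMeetNormalisedMarginWide

open Literature.MathematicalPhysics.QuantumFieldTheory.Balaban1983to89
open Literature.MathematicalPhysics.QuantumFieldTheory.Balaban1983to89.Node00
open Literature.MathematicalPhysics.QuantumFieldTheory.Balaban1983to89.B15DeterminingSets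
open Literature.MathematicalPhysics.QuantumFieldTheory.Balaban1983to89.B12RegularSpaces111 (gaugeU expI grad)
open B15Eq112TorusCover (cover)
open B14DomainGeom (Pt Within)
open B14.Eq213MaximalDomains (side cubeExt)
open B5Eq117TorusCarriers (Mk)
open B5Eq118OneStroke (iterBlockOf)
open B5Prop12FieldsLattice (distSite)
open B8Eq131Cubes (sqLo sqHi box cube)
open B8LeafModelZd (ZdIdx)
open B11Eq115Space (levOf)
open B6SectADomainsV1 (Domains)
open B6SectAOperatorsV1 (BondIdx RE dsE QpE)
open Literature.MathematicalPhysics.QuantumFieldTheory.BalabanImbrieJaffe1984to88.BIJ85AxialPropagator411 (BondSpace)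
open T4Continuum (T4Family)
open T4AxialGaugeSmallField (castSite)
open B16Sect1Backgrounds (toMS)
open GaugeField (gaugeAct)
open MatrixLog (mlog)
open Summit.QuantumFields.YangMills.Theorems.K0FlatCubeOpsTextP (flatH)
open Summit.QuantumFields.YangMills.BalabanUVNodes.N07HalvingStepTopOfLocalLetters (Letters10On)
open Summit.QuantumFields.YangMills.BalabanUVNodes.N07LocalLettersSplitCore (LocalGaugeSplitOn)
open Summit.QuantumFields.YangMills.BalabanUVNodes.N07LocalLettersCoreGuarded (DatumGaugeSplitTopStepCoreG)
open Summit.QuantumFields.YangMills.BalabanUVNodes.N07SplitClauseHeadAtMeetCube (localGaugeSplitOn_head159_meetCube_box)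
open Summit.QuantumFields.YangMills.BalabanUVNodes.N07MeetFamilyAtRecord (adm22_meetCube_trunc_seqOfRecord cover_mem_Ω_pred_of_meet_box)
open Summit.QuantumFields.YangMills.BalabanUVNodes.N07RecordDomainsAdm22 (blockSat_seqOfRecord)
open Summit.QuantumFields.YangMills.BalabanUVNodes.N07DatumGauge152Guarded (numerics_cornerP_of_levelGuard)
open Summit.QuantumFields.YangMills.BalabanUVNodes.N07SplitClauseLevelRaisingMarginWide (datumGaugeSplitTopStepCoreG_of_marginCleanPrint)
open Summit.QuantumFields.YangMills.BalabanUVNodes.N07SplitClauseHeadKnitMeetNormalised (grad_zero_fun split159_of_zero_shear)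
open Summit.QuantumFields.YangMills.BalabanUVNodes.N07ShearSizeTopBox (dist1_iter_avOfRecord_gaugeAct_one dist1_iter_avOfRecord_one)

/-! ## §1  The knit under the normalised gauge -/

open scoped Classical in
/-- ★★★ **THE MEET KNIT UNDER PRINT's NORMALISED LANDAU GAUGE, PRINT-MARGIN EDITION** (statement in the header; MODULE 59 §1 ∕ 65a with the margin-clean premise at print's width `2ρ` = «□̃ misses Ω_{j+1}»): the guarded per-datum token `DatumGaugeSplitTopStepCoreG F N suppDom Mc ρ Adm B₃ C θ Q κ a₀ a₁`
for every guard `Adm` implying the V20-G conjuncts and the run's grid numerics, every letter `κ ≥ 0`, and every normalisation predicate `Nrm`, modulo the displayed HS3NORM (print's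
(152)–(153) WITH «`ū_j = 1` on `Λ′_j`» at every meeting, print-margin-clean datum), HCHART-MEET-NORM (print's (154)–(159), shear-free), HLETTERS-NORM and HBUDGET-NORM (no `σ`, no `t_D`).
[cite: Balaban1985Variational, (144) p.300, (147)–(156) pp.301–302, (157)–(159) pp.302–303, (160)–(166) pp.303–304, (168) p.304, Prop. 8 p.304; Balaban1985RegularSpaces, Thm. 2 p.83, (1.29) p.81, p.98 (□̃), Prop. 6 (1.135)–(1.138) p.99, (1.131) p.99; Balaban1984PropagatorsII, (2.1)–(2.4) p.224, Cor. 2.8 (2.150)–(2.151) p.249] -/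
theorem datumGaugeSplitTopStepCoreG_of_normalisedGauge_of_chartMeetMarginWide (F : T4Family) (N : ℕ) [NeZero N] :
    ∃ (Mh₀ R₀ : ℕ) (CH δH BH : ℝ), 0 ≤ CH ∧ 0 < δH ∧ 0 < BH ∧
    ∀ {ρ : ℕ}
      -- structural letters: grid cube `Mc`, block height `a′` (`M_h = L^{a′} ≥ M_h⁰`), `R ≥ R₀`, the collar `ρ` with `L·M_h ∣ ρ`, `R·L·M_h ≤ ρ`, `L ≤ ρ`
      {Mc Mh R a' : ℕ} (_ : 1 ≤ Mc) (_ : Mc ≤ ρ) (_ : Mh = F.L ^ a') (_ : Mh₀ ≤ Mh) (_ : R₀ ≤ R) (_ : F.L * Mh ∣ ρ) (_ : R * (F.L * Mh) ≤ ρ) (hLρ : F.L ≤ ρ)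
      -- the two constants of the plan's V20-G guard `c ≤ ν.M₁ ∧ k + c₀ ≤ F.m + K` and their side conditions (as in FILE D)
      {c c₀ : ℕ} (_ : (11 * 4 + 4 * ρ + Mc + 3) * F.L ≤ c) (_ : Mc + 11 * 4 + 6 * ρ ≤ 2 * F.L ^ c₀) (_ : F.m ≤ c₀) (_ : a' + 3 ≤ c₀)
      -- ★ THE GUARD: any step guard implying the V20-G conjuncts AND the run's grid numerics the meet's (2.1) needs (`hgran`, `hdiv`)
      (Adm : StepGuard F) (_ : ∀ (ν : Stage7Numerics) (M : ℕ) (g : ℕ → ℝ) (K k : ℕ) (s : SeqOfRecord F ν M g K k), Adm ν M g K k s → c ≤ ν.M₁ ∧ k + c₀ ≤ F.m + K)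
      (_ : ∀ (ν : Stage7Numerics) (M : ℕ) (g : ℕ → ℝ) (K k : ℕ) (s : SeqOfRecord F ν M g K k), Adm ν M g K k s → ∀ j : ℕ, 1 ≤ j → j ≤ k →
        F.L * Mh ∣ M * RkOfRecord (F.P K).L ν.r (g j) ∧ dCubeSide (F.P K).L M (RkOfRecord (F.P K).L ν.r (g j)) j ∣ (F.P K).sitesPerDir 0)
      -- the token's letters, `0 < B₃`, the FREE (152)-letter `κ ≥ 0`, the (163)-type letter `θ_H` of the `H` doors
      {B₃ C θ Q κ a₀ a₁ θH : ℝ} (_ : 0 < B₃) (_ : 0 ≤ C) (_ : 0 ≤ θ) (_ : 0 ≤ Q) (_ : 0 ≤ κ) (_ : 8 * CH * BH * Real.exp (-(δH * (ρ : ℝ))) ≤ θH)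
      -- the chart side's PER-LEVEL SIZE LETTERS, functions of the letters `(ε, δ)` and the level only — NO shear letters `σ ∕ v ∕ av`
      (β₁ β₂ s' t₁ : (ℕ → ℝ) → (ℕ → ℝ) → ℕ → ℝ)
      -- ★ HLETTERS-NORM (RANGED): signs only, IN THE TOKEN's RANGE `0 < δ_j ≤ a₁`, `B₃δ_j ≤ ε_j ≤ a₀`
      (_ : ∀ (ε δ : ℕ → ℝ) (j : ℕ), 0 < δ j → δ j ≤ a₁ → B₃ * δ j ≤ ε j → ε j ≤ a₀ → 0 ≤ β₁ ε δ j ∧ 0 ≤ β₂ ε δ j ∧ 0 ≤ s' ε δ j)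
      -- ★ HBUDGET-NORM (RANGED): thresholds above FILE C's two floors summing STRICTLY below the token's threshold — no `t_D`, no `C_S·B_S`
      (_ : ∀ (K : ℕ) (ε δ : ℕ → ℝ) (j : ℕ), 0 < δ j → δ j ≤ a₁ → B₃ * δ j ≤ ε j → ε j ≤ a₀ → ∃ t₂ t₃ : ℝ,
        1 / 4 * ((sideP (F.P K) Mc ρ : ℕ) : ℝ) * max (4 * CH * BH * β₁ ε δ j) (θH * β₂ ε δ j) < t₂ ∧ 2 * CH * BH * s' ε δ j < t₃ ∧
        t₁ ε δ j + t₂ + t₃ < C * δ j + θ * ε j + Q * ε j ^ 2)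
      -- ★ THE NORMALISATION PREDICATE (abstract): print's «`ū_j = 1` on `Λ′_j`» in the record currency the S3 pens and the chart lane agree
      (Nrm : ∀ (ν : Stage7Numerics) (M : ℕ) (g : ℕ → ℝ) (K k : ℕ), SeqOfRecord F ν M g K k → GaugeField (F.P K) 0 (SU N) → ℕ → Pt (F.P K).d →
        GaugeTransf (F.P K) 0 (SU N) → (PBond (F.P K) 0 → MatA N) → Prop)
      -- ★ HS3NORM: [6] Thm. 2's NORMALISED local Landau gauge at every MEETING, PRINT-MARGIN-CLEAN datum — (152) letters `< κ·ε_j`, (153) for the MEET sequence, and `Nrm`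
      (_ : ∀ (ν : Stage7Numerics) (M : ℕ) (g : ℕ → ℝ) (K k : ℕ) (s : SeqOfRecord F ν M g K k), Sect2.SeqSeparated ν.M₁ s → 0 < ν.M₁ →
        Adm ν M g K k s → 1 ≤ k →
        ∀ (ε δ : ℕ → ℝ),
        (∀ n, n ≤ k → 0 < δ n ∧ δ n ≤ a₁) → (∀ n, n < k → δ n ≤ 2 * δ (n + 1)) → (∀ n, n < k → δ (n + 1) ≤ 2 * δ n) →
        (∀ n, n ≤ k → B₃ * δ n ≤ ε n ∧ ε n ≤ a₀) → (∀ n, n < k → ε n ≤ 2 * ε (n + 1)) → (∀ n, n < k → ε (n + 1) ≤ 2 * ε n) →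
        ∀ W : MSField (F.P K) (SU N), Sect2.DataSmall7PTop (avOfRecord F N K) s.Ω (suppDomOfRecord F ν K s.Ω) k δ W →
        ∀ U : GaugeField (F.P K) 0 (SU N),
        (∀ n, n ≤ k → PlaqSmallOn (Sect2.omegaPlaqsTop s.Ω (suppDomOfRecord F ν K s.Ω) n) (ε n * (F.P K).eta n ^ 2) U) →
        (∀ n, n ≤ k → Sect2.CoDivSmallOn (Sect2.omegaBondsTop s.Ω (suppDomOfRecord F ν K s.Ω) n) (ε n * (F.P K).eta n ^ 3) U) →
        AgreeOn (genSet s.Ω k) (avgFamily (avOfRecord F N K) U) W → IsCritOnFibre F N K (genSet s.Ω k) W U →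
        ∀ (n : ℕ) (hk : K - n ≤ (F.P K).m + (F.P K).K), 1 ≤ K - n → K - n ≤ k → ∀ (idx : Pt (F.P K).d),
        (∃ x ∈ box (F.P K).L (cornerP (F.P K) Mc ρ idx) (sideP (F.P K) Mc ρ) (K - n), ∃ y : Pt (F.P K).d, cover (F.P K) y ∈ s.Ω (K - n) ∧ Within ((3 : ℕ) : ℤ) x y) →
        (K - n = k ∨ ∀ z ∈ box (F.P K).L (cornerP (F.P K) Mc ρ idx - ((2 * ρ : ℕ) : Pt (F.P K).d)) (sideP (F.P K) Mc ρ + 2 * (2 * ρ)) (K - n),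
          cover (F.P K) z ∉ s.Ω (K - n + 1)) →
        ∃ (u : GaugeTransf (F.P K) 0 (SU N)) (A : PBond (F.P K) 0 → MatA N),
        (∀ b ∈ (Sect2.regionOfSet (F.P K) (cover (F.P K) '' box (F.P K).L (cornerP (F.P K) Mc ρ idx) (sideP (F.P K) Mc ρ) (K - n))).bonds,
          gaugeU (fun x => ιSU N (u x)) (fun b' => ιSU N (U b')) b = expI ((F.P K).eta (K - n)) (A b)) ∧
        (∀ b ∈ (Sect2.regionOfSet (F.P K) (cover (F.P K) '' box (F.P K).L (cornerP (F.P K) Mc ρ idx) (sideP (F.P K) Mc ρ) (K - n))).bonds,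
          ‖A b‖ < κ * ε (K - n)) ∧
        (∀ q ∈ (Sect2.regionOfSet (F.P K) (cover (F.P K) '' box (F.P K).L (cornerP (F.P K) Mc ρ idx) (sideP (F.P K) Mc ρ) (K - n))).dpairs,
          ‖grad ((F.P K).eta (K - n)) q.2.1 (fun y => A ⟨y, q.2.2⟩) q.1‖ < κ * ε (K - n)) ∧
        (∀ b ∈ Sect2.bondsDeep (cover (F.P K) '' box (F.P K).L (cornerP (F.P K) Mc ρ idx) (sideP (F.P K) Mc ρ) (K - n)),
          ‖Sect2.codiffCurlA ((F.P K).eta (K - n)) A b.src b.dir‖ < κ * ε (K - n)) ∧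
        (∀ b ∈ Sect2.bondsDeep (cover (F.P K) '' box (F.P K).L (cornerP (F.P K) Mc ρ idx) (sideP (F.P K) Mc ρ) (K - n)),
          ‖∑ ν' : Fin (F.P K).d, (((F.P K).eta (K - n) : ℝ) : ℂ)⁻¹ •
              (grad ((F.P K).eta (K - n)) ν' (fun y => A ⟨y, b.dir⟩) (b.src.unshift ν') - grad ((F.P K).eta (K - n)) ν' (fun y => A ⟨y, b.dir⟩) b.src)‖ <
            κ * ε (K - n)) ∧
        (∀ D' : Domains (F.P K), LinearMap.ker (QpE D') ≤
            LinearMap.ker (QpE (domainsMeet (cubeDomains (F.P K) (cornerP (F.P K) Mc ρ idx) (sideP (F.P K) Mc ρ) ρ (K - n) hk) (domainsOfSeq s.Ω (K - n) hk))) →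
          ∀ φ : MatA N →L[ℂ] ℂ,
          RE D' ((F.P K).eta (K - n))⁻¹ (dsE ((F.P K).eta (K - n))⁻¹ (WithLp.toLp 2 fun b => (φ (A b)).re : BondSpace (F.P K))) = 0 ∧
          RE D' ((F.P K).eta (K - n))⁻¹ (dsE ((F.P K).eta (K - n))⁻¹ (WithLp.toLp 2 fun b => (φ (A b)).im : BondSpace (F.P K))) = 0) ∧
        Nrm ν M g K k s U (K - n) idx u A)
      -- ★ HCHART-MEET-NORM: the chart lane's per-datum deliverable at PRINT's (150) FAMILY `D″` UNDER THE NORMALISED GAUGE — print's (154)–(159), shear-free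
      (_ : ∀ (ν : Stage7Numerics) (M : ℕ) (g : ℕ → ℝ) (K k : ℕ) (s : SeqOfRecord F ν M g K k), Sect2.SeqSeparated ν.M₁ s → 0 < ν.M₁ →
        Adm ν M g K k s → 1 ≤ k →
        ∀ (ε δ : ℕ → ℝ),
        (∀ n, n ≤ k → 0 < δ n ∧ δ n ≤ a₁) → (∀ n, n < k → δ n ≤ 2 * δ (n + 1)) → (∀ n, n < k → δ (n + 1) ≤ 2 * δ n) →
        (∀ n, n ≤ k → B₃ * δ n ≤ ε n ∧ ε n ≤ a₀) → (∀ n, n < k → ε n ≤ 2 * ε (n + 1)) → (∀ n, n < k → ε (n + 1) ≤ 2 * ε n) →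
        ∀ W : MSField (F.P K) (SU N), Sect2.DataSmall7PTop (avOfRecord F N K) s.Ω (suppDomOfRecord F ν K s.Ω) k δ W →
        ∀ U : GaugeField (F.P K) 0 (SU N),
        (∀ n, n ≤ k → PlaqSmallOn (Sect2.omegaPlaqsTop s.Ω (suppDomOfRecord F ν K s.Ω) n) (ε n * (F.P K).eta n ^ 2) U) →
        (∀ n, n ≤ k → Sect2.CoDivSmallOn (Sect2.omegaBondsTop s.Ω (suppDomOfRecord F ν K s.Ω) n) (ε n * (F.P K).eta n ^ 3) U) →
        AgreeOn (genSet s.Ω k) (avgFamily (avOfRecord F N K) U) W → IsCritOnFibre F N K (genSet s.Ω k) W U →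
        ∀ (n : ℕ) (hk : K - n ≤ (F.P K).m + (F.P K).K), 1 ≤ K - n → K - n ≤ k → ∀ (idx : Pt (F.P K).d),
        -- MEETING DATUMS ONLY: the print box has a point within `3` of a lift of a site of `Ω_{K−n}`
        (∃ x ∈ box (F.P K).L (cornerP (F.P K) Mc ρ idx) (sideP (F.P K) Mc ρ) (K - n), ∃ y : Pt (F.P K).d, cover (F.P K) y ∈ s.Ω (K - n) ∧ Within ((3 : ℕ) : ℤ) x y) →
        -- PRINT-MARGIN-CLEAN DATUMS ONLY (print p. 300 + (144)'s margin cube «□̃» = the print box WIDENED BY `2ρ` BLOCKS): top level, or «□̃» misses `Ω_{j+1}`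
        (K - n = k ∨ ∀ z ∈ box (F.P K).L (cornerP (F.P K) Mc ρ idx - ((2 * ρ : ℕ) : Pt (F.P K).d)) (sideP (F.P K) Mc ρ + 2 * (2 * ρ)) (K - n),
          cover (F.P K) z ∉ s.Ω (K - n + 1)) →
        -- THE FAMILY: print's (150) `Ω′_j = □_j (j < k), Ω′_k = □_k ∩ Ω_k`
        ∀ {HVd : Domains (F.P K)}
          (_ : HVd = domainsMeet (cubeDomains (F.P K) (cornerP (F.P K) Mc ρ idx) (sideP (F.P K) Mc ρ) ρ (K - n) hk) (domainsOfSeq s.Ω (K - n) hk))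
          (lo hi : ℕ → Pt (F.P K).d),
        lo 0 = (fun i => ((F.P K).L : ℤ) * (sqLo (F.P K).L (cornerP (F.P K) Mc ρ idx) ρ (K - n) 1 i - 1)) →
        hi 0 = (fun i => ((F.P K).L : ℤ) * (sqHi (F.P K).L (cornerP (F.P K) Mc ρ idx) (sideP (F.P K) Mc ρ) ρ (K - n) 1 i + 1) + (((F.P K).L : ℤ) - 1)) →
        (∀ j', 1 ≤ j' → lo j' = sqLo (F.P K).L (cornerP (F.P K) Mc ρ idx) ρ (K - n) j' - 1) →
        (∀ j', 1 ≤ j' → hi j' = sqHi (F.P K).L (cornerP (F.P K) Mc ρ idx) (sideP (F.P K) Mc ρ) ρ (K - n) j' + 1) →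
        ∃ HV : (BondIdx HVd → MatA N) →ₗ[ℂ] (PBond (F.P K) 0 → MatA N),
          (∀ (Bf : BondIdx HVd → MatA N) (b : PBond (F.P K) 0), HV Bf b = ∑ c, ((flatH (F.P K) (K - n) HVd (Pi.single c 1) b : ℝ) : ℂ) • Bf c) ∧
        ∀ (u : GaugeTransf (F.P K) 0 (SU N)) (A : PBond (F.P K) 0 → MatA N),
        (∀ b ∈ (Sect2.regionOfSet (F.P K) (cover (F.P K) '' box (F.P K).L (cornerP (F.P K) Mc ρ idx) (sideP (F.P K) Mc ρ) (K - n))).bonds,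
          gaugeU (fun x => ιSU N (u x)) (fun b' => ιSU N (U b')) b = expI ((F.P K).eta (K - n)) (A b)) →
        (∀ b ∈ (Sect2.regionOfSet (F.P K) (cover (F.P K) '' box (F.P K).L (cornerP (F.P K) Mc ρ idx) (sideP (F.P K) Mc ρ) (K - n))).bonds,
          ‖A b‖ < κ * ε (K - n)) →
        (∀ q ∈ (Sect2.regionOfSet (F.P K) (cover (F.P K) '' box (F.P K).L (cornerP (F.P K) Mc ρ idx) (sideP (F.P K) Mc ρ) (K - n))).dpairs,
          ‖grad ((F.P K).eta (K - n)) q.2.1 (fun y => A ⟨y, q.2.2⟩) q.1‖ < κ * ε (K - n)) →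
        (∀ b ∈ Sect2.bondsDeep (cover (F.P K) '' box (F.P K).L (cornerP (F.P K) Mc ρ idx) (sideP (F.P K) Mc ρ) (K - n)),
          ‖Sect2.codiffCurlA ((F.P K).eta (K - n)) A b.src b.dir‖ < κ * ε (K - n)) →
        (∀ b ∈ Sect2.bondsDeep (cover (F.P K) '' box (F.P K).L (cornerP (F.P K) Mc ρ idx) (sideP (F.P K) Mc ρ) (K - n)),
          ‖∑ ν' : Fin (F.P K).d, (((F.P K).eta (K - n) : ℝ) : ℂ)⁻¹ •
              (grad ((F.P K).eta (K - n)) ν' (fun y => A ⟨y, b.dir⟩) (b.src.unshift ν') - grad ((F.P K).eta (K - n)) ν' (fun y => A ⟨y, b.dir⟩) b.src)‖ <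
            κ * ε (K - n)) →
        (∀ D' : Domains (F.P K), LinearMap.ker (QpE D') ≤ LinearMap.ker (QpE HVd) → ∀ φ : MatA N →L[ℂ] ℂ,
          RE D' ((F.P K).eta (K - n))⁻¹ (dsE ((F.P K).eta (K - n))⁻¹ (WithLp.toLp 2 fun b => (φ (A b)).re : BondSpace (F.P K))) = 0 ∧
          RE D' ((F.P K).eta (K - n))⁻¹ (dsE ((F.P K).eta (K - n))⁻¹ (WithLp.toLp 2 fun b => (φ (A b)).im : BondSpace (F.P K))) = 0) →
        -- ★ THE NORMALISATION of this `u` (print's «ū_j = 1 on Λ′_j»), as delivered by HS3NORM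
        Nrm ν M g K k s U (K - n) idx u A →
        -- print's (154)–(159): the centre `x_c`, the DATA rows `B` ((160) near, centred; (155) far), the small datum `B′`, the (158)∕(165) summand `A₁`, and `A = A₁ + H_V B − H_V B′`
        ∃ (xc : Pt (F.P K).d) (B B' : BondIdx HVd → MatA N) (A₁ : PBond (F.P K) 0 → MatA N),
          xc ∈ box (F.P K).L (cornerP (F.P K) Mc ρ idx) (sideP (F.P K) Mc ρ) (K - n) ∧
          (∀ c : BondIdx HVd, ((c.1.1 : ℕ) = K - n ∨ blockOf c.1.2.src ∈ (cubeDomains (F.P K) (cornerP (F.P K) Mc ρ idx) (sideP (F.P K) Mc ρ) ρ (K - n) hk).Om ((c.1.1 : ℕ) + 1)) →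
            ‖B c‖ ≤ β₁ ε δ (K - n) * (distSite (Mk (F.P K) (c.1.1 : ℕ)) c.1.2.src (iterBlockOf (c.1.1 : ℕ) (cover (F.P K) xc)) + 1)) ∧
          (∀ c : BondIdx HVd, ¬ ((c.1.1 : ℕ) = K - n ∨ blockOf c.1.2.src ∈ (cubeDomains (F.P K) (cornerP (F.P K) Mc ρ idx) (sideP (F.P K) Mc ρ) ρ (K - n) hk).Om ((c.1.1 : ℕ) + 1)) →
            ‖B c‖ ≤ β₂ ε δ (K - n) * ((ρ : ℝ) + ((sideP (F.P K) Mc ρ : ℕ) : ℝ))) ∧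
          (∀ c, ‖B' c‖ ≤ s' ε δ (K - n)) ∧
          Letters10On (cover (F.P K) '' box (F.P K).L (cornerP (F.P K) Mc ρ idx) (sideP (F.P K) Mc ρ) (K - n)) ((F.P K).eta (K - n)) (t₁ ε δ (K - n)) A₁ ∧
          (∀ b, A b = A₁ b + HV B b - HV B' b)),
      DatumGaugeSplitTopStepCoreG F N (fun ν K Ω => suppDomOfRecord F ν K Ω) Mc ρ Adm B₃ C θ Q κ a₀ a₁ := by
  obtain ⟨Mh₀, R₀, CS, BS, CH, δH, BH, -, -, hCH, hδH, hBH, hmain⟩ := localGaugeSplitOn_head159_meetCube_box F N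
  refine ⟨Mh₀, R₀, CH, δH, BH, hCH, hδH, hBH, ?_⟩
  intro ρ Mc Mh R a' hMc hMcρ hMha hMh hR hdvd hRρ hLρ c c₀ hc hc₀ hmc₀ hac₀ Adm hAdm₁ hAdm₂ B₃ C θ Q κ a₀ a₁ θH hB₃ hC0 hθ0 hQ0 hκ0 h163
    β₁ β₂ s' t₁ hletters hbudget Nrm hS3 hchart
  -- the width-generic margin level-raising reduction at PRINT's width `w = 2ρ` (MODULE 66): the clause is owed at PRINT-MARGIN-CLEAN datums whose print box MEETS `Ω_j`
  refine datumGaugeSplitTopStepCoreG_of_marginCleanPrint F N hMc hMcρ hB₃.le hκ0 hC0 hθ0 hQ0 ?_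
  intro ν M g K k s hsep hM₁ hadm hk ε δ hδ hcompδ hcompδ' hε hεcomp hεcomp' W h7 U h17 h19 hfib hcrit j hj hjk a hmeet hclean
  -- the guard's two halves: the V20-G conjuncts and the run's grid numerics
  have hV20 : c ≤ ν.M₁ ∧ k + c₀ ≤ F.m + K := hAdm₁ ν M g K k s hadm
  have hgrid := hAdm₂ ν M g K k s hadm
  -- the level guard with `F.m ≤ c₀` puts every datum level below `K`: write it as `K − n`
  have hkK : k ≤ K := by have := hV20.2; omega
  obtain ⟨n, rfl⟩ : ∃ n, j = K - n := ⟨K - j, by omega⟩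
  have hk1 : 1 ≤ K - n := hj
  have hkP : K - n ≤ (F.P K).m + (F.P K).K := by
    have : (F.P K).m + (F.P K).K = F.m + K := rfl
    omega
  have hLρ' : (F.P K).L ≤ ρ := hLρ
  -- the letters' ranges at the datum's level
  have hr1 : 0 < δ (K - n) := (hδ _ hjk).1
  have hr2 : δ (K - n) ≤ a₁ := (hδ _ hjk).2
  have hr3 : B₃ * δ (K - n) ≤ ε (K - n) := (hε _ hjk).1
  have hr4 : ε (K - n) ≤ a₀ := (hε _ hjk).2
  obtain ⟨hβ₁, hβ₂, hs'⟩ := hletters ε δ (K - n) hr1 hr2 hr3 hr4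
  obtain ⟨t₂, t₃, ht₂, ht₃, hsum⟩ := hbudget K ε δ (K - n) hr1 hr2 hr3 hr4
  -- ★ S3's NORMALISED gauge at this meeting, clean datum (HS3NORM), and the datum's numerics from the level guard
  obtain ⟨u, A, he, hA, hdA, hcd, hlap, h6, hnrm⟩ := hS3 ν M g K k s hsep hM₁ hadm hk ε δ hδ hcompδ hcompδ' hε hεcomp hεcomp' W h7 U h17 h19
    hfib hcrit n hkP hk1 hjk a hmeet hclean
  obtain ⟨ha, hM, hper, hinj⟩ := numerics_cornerP_of_levelGuard F hk1 hjk hV20.2 hMha (by omega) hLρ' hdvd hc₀ a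
  have hρpos : 0 < ρ := lt_of_lt_of_le (F.P K).L_pos hLρ'
  have hM1 : 1 ≤ sideP (F.P K) Mc ρ := by have := le_sideP (P := F.P K) Mc hρpos; omega
  -- the canonical boxes of the datum's tower
  set lo : ℕ → Pt (F.P K).d := fun j' => if j' = 0 then (fun i => ((F.P K).L : ℤ) * (sqLo (F.P K).L (cornerP (F.P K) Mc ρ a) ρ (K - n) 1 i - 1))
    else sqLo (F.P K).L (cornerP (F.P K) Mc ρ a) ρ (K - n) j' - 1 with hlo
  set hi : ℕ → Pt (F.P K).d := fun j' => if j' = 0 then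
      (fun i => ((F.P K).L : ℤ) * (sqHi (F.P K).L (cornerP (F.P K) Mc ρ a) (sideP (F.P K) Mc ρ) ρ (K - n) 1 i + 1) + (((F.P K).L : ℤ) - 1))
    else sqHi (F.P K).L (cornerP (F.P K) Mc ρ a) (sideP (F.P K) Mc ρ) ρ (K - n) j' + 1 with hhi
  have hlo0 : lo 0 = fun i => ((F.P K).L : ℤ) * (sqLo (F.P K).L (cornerP (F.P K) Mc ρ a) ρ (K - n) 1 i - 1) := by simp [hlo]
  have hhi0 : hi 0 = fun i => ((F.P K).L : ℤ) * (sqHi (F.P K).L (cornerP (F.P K) Mc ρ a) (sideP (F.P K) Mc ρ) ρ (K - n) 1 i + 1) + (((F.P K).L : ℤ) - 1) := by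
    simp [hhi]
  have hloj : ∀ j', 1 ≤ j' → lo j' = sqLo (F.P K).L (cornerP (F.P K) Mc ρ a) ρ (K - n) j' - 1 := fun j' hj' => by
    simp [hlo, Nat.one_le_iff_ne_zero.mp hj']
  have hhij : ∀ j', 1 ≤ j' → hi j' = sqHi (F.P K).L (cornerP (F.P K) Mc ρ a) (sideP (F.P K) Mc ρ) ρ (K - n) j' + 1 := fun j' hj' => by
    simp [hhi, Nat.one_le_iff_ne_zero.mp hj']
  -- THE RECORD SIDE OF THE MEET: nesting, block saturation (grid numerics), the window's collar «π(□) ⊆ Ω_{K−n−1}» (57a), and `Adm22 D″ R (L·M_h)` (FILE D0)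
  have hnest : ∀ i : ℕ, 1 ≤ i → i < K - n → s.Ω (i + 1) ⊆ s.Ω i := fun i h1 hi => s.chain.Ω_succ_subset_Ω h1 (lt_of_lt_of_le hi hjk)
  have hdiv : ∀ j' : ℕ, 1 ≤ j' → j' ≤ K - n → dCubeSide (F.P K).L M (RkOfRecord (F.P K).L ν.r (g j')) j' ∣ (F.P K).sitesPerDir 0 :=
    fun j' h1 hj' => (hgrid j' h1 (hj'.trans hjk)).2
  have hgran : ∀ j' : ℕ, 1 ≤ j' → j' ≤ K - n → F.L * Mh ∣ M * RkOfRecord (F.P K).L ν.r (g j') := fun j' h1 hj' => (hgrid j' h1 (hj'.trans hjk)).1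
  have hsat : ∀ (j' : ℕ) (x x' : Site (F.P K) 0), 1 ≤ j' → j' ≤ K - n → iterBlockOf j' x = iterBlockOf j' x' → x ∈ s.Ω j' → x' ∈ s.Ω j' :=
    fun j' x x' h1 hj' => blockSat_seqOfRecord F ν M g K k (by have : (F.P K).m + (F.P K).K = F.m + K := rfl; omega) s (fun i h1 hi => (hgrid i h1 hi).2) j' x x' h1
      (hj'.trans hjk)
  have hν1 : 1 ≤ ν.M₁ := hM₁
  have hfloor : 11 * (F.P K).d + 2 * ρ + Mc + 3 ≤ ν.M₁ := by
    have hd : (F.P K).d = 4 := rfl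
    have hL1 : 1 ≤ F.L := by have := F.hL11; omega
    have : (11 * 4 + 4 * ρ + Mc + 3) ≤ (11 * 4 + 4 * ρ + Mc + 3) * F.L := Nat.le_mul_of_pos_right _ hL1
    rw [hd]; omega
  have hbox' : 2 ≤ K - n → ∀ z ∈ box (F.P K).L (cornerP (F.P K) Mc ρ a) (sideP (F.P K) Mc ρ) (K - n), cover (F.P K) z ∈ s.Ω (K - n - 1) :=
    fun h2 => cover_mem_Ω_pred_of_meet_box F ν M g K k s hν1 hsep hfloor h2 hjk hmeet
  have hLMh : 1 ≤ F.L * Mh := by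
    rw [hMha]
    exact Nat.one_le_iff_ne_zero.mpr (Nat.mul_ne_zero (by have := F.hL11; omega) (pow_ne_zero _ (by have := F.hL11; omega)))
  have hRsep : R * (F.L * Mh) + 1 ≤ (F.P K).L * ν.M₁ := by
    have hLP : (F.P K).L = F.L := rfl
    have hL1 : 1 ≤ F.L := by have := F.hL11; omega
    have h1 : ν.M₁ ≤ F.L * ν.M₁ := Nat.le_mul_of_pos_left _ hL1
    have h2 : ρ + 1 ≤ c := by
      have : (11 * 4 + 4 * ρ + Mc + 3) ≤ (11 * 4 + 4 * ρ + Mc + 3) * F.L := Nat.le_mul_of_pos_right _ hL1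
      omega
    rw [hLP]; omega
  have hAdmD := adm22_meetCube_trunc_seqOfRecord F ν M g K k s hjk hkP hLMh hν1 hRsep hsep hdiv hgran hdvd ha hM hper hRρ
  -- the chart side at this MEETING, CLEAN datum, at print's family, UNDER THE NORMALISED GAUGE: print's (154)–(159), no shear devices
  obtain ⟨HV, hHV, hch⟩ := hchart ν M g K k s hsep hM₁ hadm hk ε δ hδ hcompδ hcompδ' hε hεcomp hεcomp' W h7 U h17 h19 hfib hcrit n hkP hk1 hjk a hmeet hclean rfl
    lo hi hlo0 hhi0 hloj hhij
  obtain ⟨xc, B, B', A₁, hxc, hX₁, hX₂, hB', h₁, h159⟩ := hch u A he hA hdA hcd hlap h6 hnrm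
  -- FILE C at this datum AT ZERO SHEAR (`u_L := 1, U₁ := 1, λ := 0, X := 0, v := av := 0, σ := 0`, `t_D :=` the budget's slack), then the token's threshold exactly
  have hDσ : ∀ j' ≤ K - n, ((((F.P K).d * ((sideP (F.P K) Mc ρ + 4 * ρ + 3) * (F.P K).L ^ ((K - n) - j'))) : ℕ) : ℝ) * ((0 : ℝ) + 0) ≤ 0 :=
    fun _ _ => by simp
  have hv : ∀ j' ≤ K - n, ∀ c' : PBond (F.P K) j', c'.src ∈ (castSite '' Set.Icc (lo j') (hi j') : Set (Site (F.P K) j')) →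
      c'.tgt ∈ (castSite '' Set.Icc (lo j') (hi j') : Set (Site (F.P K) j')) →
        dist1 (Averaging.iter (avOfRecord F N K) j' (gaugeAct (fun _ => (1 : SU N)) (1 : GaugeField (F.P K) 0 (SU N))) c') ≤ (0 : ℝ) :=
    fun j' _ c' _ _ => dist1_iter_avOfRecord_gaugeAct_one F N K j' c'
  have hav : ∀ j' ≤ K - n, ∀ c' : PBond (F.P K) j', c'.src ∈ (castSite '' Set.Icc (lo j') (hi j') : Set (Site (F.P K) j')) →
      c'.tgt ∈ (castSite '' Set.Icc (lo j') (hi j') : Set (Site (F.P K) j')) →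
        dist1 (Averaging.iter (avOfRecord F N K) j' (1 : GaugeField (F.P K) 0 (SU N)) c') ≤ (0 : ℝ) :=
    fun j' _ c' _ _ => dist1_iter_avOfRecord_one F N K j' c'
  have hlam : ∀ (j' : ℕ) (y : Site (F.P K) j'), ‖(fun (_ : ℕ) (_ : Site (F.P K) j') => (0 : MatA N)) j' y‖ ≤
      ‖mlog (((((toMS (fun _ : Site (F.P K) 0 => (1 : SU N)) j' (castSite (lo j')))⁻¹ * toMS (fun _ : Site (F.P K) 0 => (1 : SU N)) j' y)⁻¹ : SU N)) : MatA N)‖ :=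
    fun _ _ => by rw [norm_zero]; exact norm_nonneg _
  have hX : ∀ c' : BondIdx (domainsMeet (cubeDomains (F.P K) (cornerP (F.P K) Mc ρ a) (sideP (F.P K) Mc ρ) ρ (K - n) hkP) (domainsOfSeq s.Ω (K - n) hkP)),
      (fun _ => (0 : MatA N)) c' = LatticeFieldCalculus.grad (((F.P K).L : ℝ) ^ (K - n) / ((F.P K).L : ℝ) ^ (c'.1.1 : ℕ))
        ((fun (_ : ℕ) (_ : Site (F.P K) _) => (0 : MatA N)) c'.1.1) c'.1.2 :=
    fun c' => (grad_zero_fun _ _).symm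
  have h159' : ∀ b, A b - HV (fun _ => (0 : MatA N)) b = A₁ b + HV B b - HV B' b := split159_of_zero_shear HV h159
  set tD : ℝ := C * δ (K - n) + θ * ε (K - n) + Q * ε (K - n) ^ 2 - (t₁ ε δ (K - n) + t₂ + t₃) with htD_def
  have htD : 2 * CS * BS * (4 * (0 : ℝ)) < tD := by
    have h0 : (0 : ℝ) < tD := sub_pos.mpr hsum
    simpa using h0
  have hclause := hmain n K hk1 (by omega) hkP hMha hMh hR (by omega) hM1 hLρ hinj s.Ω hnest hsat hbox' hAdmD hHV hxc hβ₁ hβ₂ h163 hX₁ hX₂ hs' hB'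
    hlo0 hhi0 hloj hhij (fun _ => (1 : SU N)) (1 : GaugeField (F.P K) 0 (SU N)) (fun _ => (0 : ℝ)) (fun _ => (0 : ℝ)) (fun _ => le_rfl) (fun _ => le_rfl)
    (by norm_num) hDσ hv hav (fun (_ : ℕ) (_ : Site (F.P K) _) => (0 : MatA N)) hlam hX u he hA hdA h₁ h159' ht₂ ht₃ htD
  exact hclause.of_le le_rfl (le_of_eq (by rw [htD_def]; ring))

end Summit.QuantumFields.YangMills.BalabanUVNodes.N07SplitClauseHeadKnitMeetNormalisedMarginWide

end
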